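import Literature.Computability.Complexity.HardLangMachine
import Literature.Computability.Complexity.IWStrongLanguage
import HarnessLib

/-!
# The strongly hard language is in `E`: the machine (Impagliazzo–Wigderson 1997, Thm. 1, computational half)

The computational half of the mild-to-strong step of hardness amplification inside `E`: for
`L₁ ∈ E`, the language `IWStrong.strongLang q L₁` of `IWStrongLanguage.lean` (slices = the
Impagliazzo–Wigderson / Healy–Vadhan–Viola code `Amp` of the slices of `L₁` over the greedy block
family and the Hankel hitter, with `2^{O(N)}` blocks) is in `E` (**`IWStrongM.strongLang_mem_E`**).
As for `HardLangMachine.lean`: an explicit polynomial-time string function `topF` decides the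
linearly-exponentially PADDED language (`strongLangPad ∈ P`), and upward translation
(`ExpPadding.exists_timeDecidable_of_expPad`, `HardLangM.translation_bound`) gives `E`.

Bricks (all `∈ FP`, with value lemmas): U1 the parameters in unary from the scale (`uNF`, `uLogF`,
`uAF`, `uMF`, `uDF`, `uSeedLenF`); U2 the scale of the payload (`scaleOfF_apply`: `1^{scaleOf |x|}`,
a keep-last fold as `HardLangM.etaOfF`); U7 one block: the Hankel hit string as a fold of xors of
windows (`hitF`, `hitStr`, `getD_hitStr`), the index bits (`ibF`), the restriction of the seed through
the `i`-th design word (`xsCF`, by the tree's `NWMachine.resF`/`designF`/`nthItemFn`), the xor and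
the oracle call (`blockPieceF_apply`, by `NWMachine.evalF`); U8 the xor of the `2ᵃ` answers
(`ampF_apply`); U9 the top level (`cBricks_apply`: parsing `x = X ‖ TT ‖ BB ‖ junk`, the design by
`NWMachine.designF` on `1^{2^{t-1}}`, the size test on the last needed word); V2 the semantics:
**`ofFn_inp_eq_inpStr`** (the machine's block input is `IWAmp.inp` of the parsed seed: positions
`b r + wᵢ(r)` of the `x`-part, and the Hankel bit `Σ_c t_{r+c} idxᵢ(c) + b_r` over `𝔽₂` as an
xor-fold), `parityFin_eq_foldl`, `lastWord_eq_nil_iff`, `strongFn_zero`, whence `coreF_apply`: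
the core computes `IWStrong.strongBit q L₁ x` given an oracle for `L₁` within budget `Q(2^{|x|})`
(`NWMachine.exists_run_of_mem_E`).

## References

* R. Impagliazzo, A. Wigderson, *P = BPP if E requires exponential circuits: derandomizing the XOR
  lemma*, STOC 1997, Thm. 1 ("if `f ∈ E` then the amplified function is in `E`")
  [ImpagliazzoWigderson1997].
* S. Arora, B. Barak, *Computational Complexity: A Modern Approach*, CUP 2009, Thm. 19.27 and
  §20.2 [AroraBarakCC2009].
-/

noncomputable section

namespace Literature.Computability.Complexity

open _root_.Computability Polynomial Brick Plumb GF2Str Literature.InformationTheory.Coding MetaComplexity IWAmpBridge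

namespace IWStrongM

variable (q : ℕ)

/-! ### U1. The parameters in unary, from the scale `1ᵗ` -/

/-- `1ᵗ ↦ 1ᴺ`, `N = 2q t`. [folklore] -/
def uNF : List Bool → List Bool := onesMulFn (2 * q)

/-- `1ᵗ ↦ 1^{⌊log₂ N⌋ + 1}`. [folklore] -/
def uLogF : List Bool → List Bool := List.cons true ∘ logFn ∘ uNF q

/-- `1ᵗ ↦ 1^{a}`, `a = t + 6(⌊log₂ N⌋ + 1) + 3`. [folklore] -/
def uAF : List Bool → List Bool := fun w => w ++ onesMulFn 6 (uLogF q w) ++ [true, true, true]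

/-- `1ᵗ ↦ 1^{m}`, `m = a + 1`. [folklore] -/
def uMF : List Bool → List Bool := fun w => uAF q w ++ [true]

/-- `1ᵗ ↦ 1^{d}`, `d = N 2^{4q}`. [folklore] -/
def uDF : List Bool → List Bool := onesMulFn (2 ^ (4 * q)) ∘ uNF q

/-- `1ᵗ ↦ 1^{seedLen}`, `seedLen = d + ((N + m) + N)`. [folklore] -/
def uSeedLenF : List Bool → List Bool := fun w => uDF q w ++ ((uNF q w ++ uMF q w) ++ uNF q w)

/-- The parameter bricks are in `FP`. [folklore] -/
theorem uBricks_mem_FP : uNF q ∈ FP ∧ uLogF q ∈ FP ∧ uAF q ∈ FP ∧ uMF q ∈ FP ∧ uDF q ∈ FP ∧ uSeedLenF q ∈ FP := by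
  have hN : uNF q ∈ FP := onesMulFn_mem_FP _
  have hL : uLogF q ∈ FP := comp_mem_FP (cons_mem_FP true) (comp_mem_FP logFn_mem_FP hN)
  have hA' : (onesMulFn 6 ∘ uLogF q) ∈ FP := comp_mem_FP (g := onesMulFn 6) (f := uLogF q) (onesMulFn_mem_FP 6) hL
  have hA : uAF q ∈ FP := append_mem_FP (append_mem_FP (PolyTimeComputable.id _) hA') (const_mem_FP _)
  have hM : uMF q ∈ FP := append_mem_FP hA (const_mem_FP _)
  have hD : uDF q ∈ FP := comp_mem_FP (onesMulFn_mem_FP _) hN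
  exact ⟨hN, hL, hA, hM, hD, append_mem_FP hD (append_mem_FP (append_mem_FP hN hM) hN)⟩

/-- Values of the parameter bricks on `1ᵗ`. [folklore] -/
theorem uBricks_apply (t : ℕ) : uNF q (ones t) = ones (IWStrong.NOf q t) ∧ uLogF q (ones t) = ones (Nat.log 2 (IWStrong.NOf q t) + 1) ∧
    uAF q (ones t) = ones (IWStrong.aOf q t) ∧ uMF q (ones t) = ones (IWStrong.mOf q t) ∧ uDF q (ones t) = ones (IWStrong.dOf q t) ∧
    uSeedLenF q (ones t) = ones (IWStrong.seedLen q t) := by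
  have hN : uNF q (ones t) = ones (IWStrong.NOf q t) := by simp [uNF, onesMulFn, ones, IWStrong.NOf]
  have hL : uLogF q (ones t) = ones (Nat.log 2 (IWStrong.NOf q t) + 1) := by
    simp [uLogF, hN, logFn, ones, List.replicate_succ]
  have hA : uAF q (ones t) = ones (IWStrong.aOf q t) := by
    simp only [uAF, hL, onesMulFn, ones, List.length_replicate, IWStrong.aOf]
    simp [Nat.add_assoc]
    rfl
  have hM : uMF q (ones t) = ones (IWStrong.mOf q t) := by
    simp only [uMF, hA, ones, IWStrong.mOf, List.replicate_succ']
  have hD : uDF q (ones t) = ones (IWStrong.dOf q t) := by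
    simp [uDF, hN, onesMulFn, ones, IWStrong.dOf, IWStrong.bOf, mul_comm]
  refine ⟨hN, hL, hA, hM, hD, ?_⟩
  simp only [uSeedLenF, hD, hN, hM, ones, ← List.replicate_add, IWStrong.seedLen]

/-! ### U2. The scale of the payload -/

/-- **The scale piece** on `⟨x, 1^{t'}⟩`: `1 1^{t'}` if `seedLen t' ≤ |x|`, else `[]`. [folklore] -/
def scalePieceF : List Bool → List Bool :=
  iteFn (notFn (ltFn ∘ fanoutFn (lenBinF ∘ fstF) (lenBinF ∘ uSeedLenF q ∘ sndF))) (List.cons true ∘ sndF) fun _ => []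

/-- `scalePieceF ∈ FP`. [folklore] -/
theorem scalePieceF_mem_FP : scalePieceF q ∈ FP :=
  iteFn_mem_FP (notFn_mem_FP (comp_mem_FP ltFn_mem_FP (fanoutFn_mem_FP (comp_mem_FP lenBinF_mem_FP fstF_mem_FP)
    (comp_mem_FP lenBinF_mem_FP (comp_mem_FP (uBricks_mem_FP q).2.2.2.2.2 sndF_mem_FP)))))
    (comp_mem_FP (cons_mem_FP true) sndF_mem_FP) (const_mem_FP _)

/-- Value of the scale piece. [folklore] -/
theorem scalePieceF_apply (x : List Bool) (t' : ℕ) :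
    scalePieceF q (boolPair x (ones t')) = if IWStrong.seedLen q t' ≤ x.length then true :: ones t' else [] := by
  have hc : notFn (ltFn ∘ fanoutFn (lenBinF ∘ fstF) (lenBinF ∘ uSeedLenF q ∘ sndF)) (boolPair x (ones t')) =
      [!decide (x.length < IWStrong.seedLen q t')] :=
    notFn_apply (by
      simp only [Function.comp_apply, fanoutFn_apply, fstF_boolPair, sndF_boolPair, lenBinF_apply, (uBricks_apply q t').2.2.2.2.2,
        ltFn_boolPair, bitsToNat_encodeNat]
      simp [ones])
  rw [scalePieceF, iteFn_apply hc]
  by_cases h : IWStrong.seedLen q t' ≤ x.length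
  · rw [if_pos h, if_pos (by simpa using h), Function.comp_apply, sndF_boolPair]
  · rw [if_neg h, if_neg (by simpa using h)]

/-- **The scale brick** `scaleOfF x = 1^{scaleOf |x|}`: the keep-last fold of the scale pieces. [folklore] -/
def scaleOfF : List Bool → List Bool :=
  dropFn ∘ fanoutFn (fun _ => [true]) (sndPow 2 ∘ foldLoop HardLangM.keepOpF (clipF 2 (scalePieceF q)) (X + 1) ∘
    fanoutFn (fun w => w) (fanoutFn (lenBinF ∘ List.cons true) fun _ => boolPair [] []))

/-- `scaleOfF ∈ FP`. [folklore] -/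
theorem scaleOfF_mem_FP : scaleOfF q ∈ FP :=
  comp_mem_FP dropFn_mem_FP (fanoutFn_mem_FP (const_mem_FP _) (comp_mem_FP (sndPow_mem_FP 2) (comp_mem_FP
    (foldLoop_clipF_mem_FP 2 HardLangM.keepOpF_mem_FP HardLangM.length_keepOpF_le (scalePieceF_mem_FP q) _)
    (fanoutFn_mem_FP (PolyTimeComputable.id _) (fanoutFn_mem_FP (comp_mem_FP lenBinF_mem_FP (cons_mem_FP true)) (const_mem_FP _))))))

/-- **Value of the scale brick.** [folklore] -/
theorem scaleOfF_apply (x : List Bool) : scaleOfF q x = ones (IWStrong.scaleOf q x.length) := by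
  have hk : x.length + 1 ≤ (X + 1 : Polynomial ℕ).eval x.length := by simp
  have hloop := foldLoop_apply HardLangM.keepOpF (clipF 2 (scalePieceF q)) hk 0 []
  rw [show ones 0 = ([] : List Bool) from rfl] at hloop
  simp only [scaleOfF, Function.comp_apply, fanoutFn_apply, lenBinF_apply, List.length_cons, dropFn_boolPair]
  rw [hloop, sndPow_succ_boolPair, sndPow_succ_boolPair, sndPow_zero_boolPair, foldAcc_clipF (fun j _ hj => by
    rw [scalePieceF_apply]
    split_ifs
    · simp [ones]; omega
    · simp)]
  rw [HardLangM.foldAcc_eq_foldl HardLangM.keepOpF (scalePieceF q) x (fun a b => if b = [] then a else b)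
    (fun t' => if IWStrong.seedLen q t' ≤ x.length then true :: ones t' else []) _ _ _
    (fun a j _ _ => by rw [HardLangM.keepOpF_apply, fstF_boolPair, sndF_boolPair]) (fun j _ _ => scalePieceF_apply q x j),
    ← List.range_eq_range', HardLangM.foldl_keepLast (fun t' => IWStrong.seedLen q t' ≤ x.length) (fun t' => true :: ones t') (by simp),
    IWStrong.scaleOf]
  split_ifs with h
  · simp [ones]
  · have h0 : Nat.findGreatest (fun t' => IWStrong.seedLen q t' ≤ x.length) x.length = 0 := by
      rw [Nat.findGreatest_eq_zero_iff]
      intro n _ hn hPn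
      exact h (Nat.findGreatest_spec (P := fun t' => IWStrong.seedLen q t' ≤ x.length) hn hPn)
    rw [h0]; simp [ones]

/-! ### U7a. The Hankel hit string `hit = BB ⊕ ⊕_{c : bit c of i} TT[c, c+N)` -/

/-- `getD` of an xor of strings. [folklore] -/
theorem getD_xorStr (l l' : List Bool) (i : ℕ) : (xorStr l l').getD i false = xor (l.getD i false) (l'.getD i false) := by
  have h := coeff_polyOfBits (xorStr l l') i
  rw [polyOfBits_xorStr, Polynomial.coeff_add, coeff_polyOfBits, coeff_polyOfBits] at h
  cases hl : l.getD i false <;> cases hl' : l'.getD i false <;> cases hx : (xorStr l l').getD i false <;>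
    simp_all [bitZ]

/-- The window piece on `⟨⟨⟨TT, BB⟩, ⟨ib, 1ᴺ⟩⟩, 1ᶜ⟩`: the window `TT[c, c+N)` if bit `c` of `ib` is set, else `[]`. [folklore] -/
def winPieceF : List Bool → List Bool :=
  iteFn (bitAtFn ∘ fanoutFn sndF ((fun w => w ++ [false]) ∘ fstF ∘ sndF ∘ fstF))
    (takeFn ∘ fanoutFn (sndF ∘ sndF ∘ fstF) (dropFn ∘ fanoutFn sndF (fstF ∘ fstF ∘ fstF)))
    fun _ => []

/-- `winPieceF ∈ FP`. [folklore] -/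
theorem winPieceF_mem_FP : winPieceF ∈ FP :=
  iteFn_mem_FP (comp_mem_FP bitAtFn_mem_FP (fanoutFn_mem_FP sndF_mem_FP
      (comp_mem_FP (append_mem_FP (PolyTimeComputable.id _) (const_mem_FP _)) (comp_mem_FP fstF_mem_FP (comp_mem_FP sndF_mem_FP fstF_mem_FP)))))
    (comp_mem_FP takeFn_mem_FP (fanoutFn_mem_FP (comp_mem_FP sndF_mem_FP (comp_mem_FP sndF_mem_FP fstF_mem_FP))
      (comp_mem_FP dropFn_mem_FP (fanoutFn_mem_FP sndF_mem_FP (comp_mem_FP fstF_mem_FP (comp_mem_FP fstF_mem_FP fstF_mem_FP))))))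
    (const_mem_FP _)

/-- The hit context. [folklore] -/
def hCtx (TT BB ib : List Bool) (N : ℕ) : List Bool := boolPair (boolPair TT BB) (boolPair ib (ones N))

/-- Value of the window piece. [folklore] -/
theorem winPieceF_apply (TT BB ib : List Bool) (N : ℕ) {c : ℕ} (hcl : c ≤ ib.length) :
    winPieceF (boolPair (hCtx TT BB ib N) (ones c)) = if ib.getD c false then (TT.drop c).take N else [] := by
  have hc : (bitAtFn ∘ fanoutFn sndF ((fun w => w ++ [false]) ∘ fstF ∘ sndF ∘ fstF)) (boolPair (hCtx TT BB ib N) (ones c)) =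
      [ib.getD c false] := by
    simp only [Function.comp_apply, fanoutFn_apply, sndF_boolPair, fstF_boolPair, hCtx, bitAtFn_boolPair, ones, List.length_replicate]
    -- `(ib ++ [0]).drop c` starts with `ib[c]` (or is `[0]`/`[]` past the end)
    have key : ((ib ++ [false]).drop c).take 1 = [ib.getD c false] := by
      rw [List.getD_eq_getElem?_getD]
      by_cases h : c < ib.length
      · rw [List.drop_append_of_le_length h.le]
        obtain ⟨l', hl'⟩ : ∃ l', ib.drop c = ib[c] :: l' := ⟨ib.drop (c + 1), (List.drop_eq_getElem_cons h)⟩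
        rw [hl']
        simp [List.getElem?_eq_getElem h]
      · push Not at h
        rw [List.getElem?_eq_none h]
        have h1 : c = ib.length := le_antisymm hcl h
        subst h1; simp
    exact key
  rw [winPieceF, iteFn_apply hc]
  split_ifs
  · simp [hCtx, ones]
  · rfl

/-- **The hit brick** on `⟨⟨TT, BB⟩, ⟨ib, 1ᴺ⟩⟩`: `BB[0,N) ⊕ ⊕_{c < |ib|, ib[c]} TT[c, c+N)` (the Hankel
matrix–vector product plus the shift, as a fold of xors of windows). [folklore] -/
def hitF : List Bool → List Bool :=
  sndPow 2 ∘ foldLoop HardLangM.xorF (clipF 1 winPieceF) X ∘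
    fanoutFn (fun w => w) (fanoutFn (lenBinF ∘ fstF ∘ sndF) (fanoutFn (fun _ => []) (takeFn ∘ fanoutFn (sndF ∘ sndF) (sndF ∘ fstF))))

/-- `hitF ∈ FP`. [folklore] -/
theorem hitF_mem_FP : hitF ∈ FP :=
  comp_mem_FP (sndPow_mem_FP 2) (comp_mem_FP
    (foldLoop_clipF_mem_FP 1 HardLangM.xorF_mem_FP HardLangM.length_xorF_le winPieceF_mem_FP _)
    (fanoutFn_mem_FP (PolyTimeComputable.id _) (fanoutFn_mem_FP (comp_mem_FP lenBinF_mem_FP (comp_mem_FP fstF_mem_FP sndF_mem_FP))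
      (fanoutFn_mem_FP (const_mem_FP _) (comp_mem_FP takeFn_mem_FP (fanoutFn_mem_FP (comp_mem_FP sndF_mem_FP sndF_mem_FP) (comp_mem_FP sndF_mem_FP fstF_mem_FP)))))))

/-- The hit string as a fold (the model of `hitF`). [folklore] -/
def hitStr (TT BB ib : List Bool) (N : ℕ) : List Bool :=
  (List.range ib.length).foldl (fun acc c => xorStr acc (if ib.getD c false then (TT.drop c).take N else [])) (BB.take N)

/-- **Value of the hit brick.** [folklore] -/
theorem hitF_apply (TT BB ib : List Bool) (N : ℕ) : hitF (hCtx TT BB ib N) = hitStr TT BB ib N := by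
  have hk : ib.length ≤ (X : Polynomial ℕ).eval (hCtx TT BB ib N).length := by
    simp only [eval_X, hCtx, length_boolPair]; omega
  have hloop := foldLoop_apply HardLangM.xorF (clipF 1 winPieceF) hk 0 (BB.take N)
  simp only [hitF, Function.comp_apply, fanoutFn_apply, lenBinF_apply]
  have e1 : fstF (sndF (hCtx TT BB ib N)) = ib := by simp [hCtx]
  have e2 : takeFn (boolPair (sndF (sndF (hCtx TT BB ib N))) (sndF (fstF (hCtx TT BB ib N)))) = BB.take N := by
    simp [hCtx, ones]
  rw [e1, e2, show ([] : List Bool) = ones 0 from rfl, hloop, sndPow_succ_boolPair, sndPow_succ_boolPair, sndPow_zero_boolPair,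
    foldAcc_clipF (fun j _ hj => by
      rw [winPieceF_apply TT BB ib N (by omega)]
      split_ifs
      · simp only [List.length_take, List.length_drop, hCtx, length_boolPair, ones, List.length_replicate]; omega
      · simp),
    HardLangM.foldAcc_eq_foldl HardLangM.xorF winPieceF (hCtx TT BB ib N) (fun a b => xorStr a b)
      (fun c => if ib.getD c false then (TT.drop c).take N else []) _ _ _
      (fun a j _ _ => HardLangM.xorF_apply _ _) (fun j _ hj => winPieceF_apply TT BB ib N (by omega)),
    ← List.range_eq_range']
  rfl

/-- `getD` of the hit string: `BB[r] ⊕ ⊕_{c < |ib|} (ib[c] ∧ TT[r + c])` for `r < N`. [folklore] -/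
theorem getD_hitStr (TT BB ib : List Bool) (N : ℕ) {r : ℕ} (hr : r < N) :
    (hitStr TT BB ib N).getD r false =
      xor (BB.getD r false) ((List.range ib.length).foldl (fun b c => xor b (ib.getD c false && TT.getD (c + r) false)) false) := by
  unfold hitStr
  suffices ∀ (L : List ℕ) (acc : List Bool) (b0 : Bool), acc.getD r false = xor (BB.getD r false) b0 →
      ((L.foldl (fun acc c => xorStr acc (if ib.getD c false then (TT.drop c).take N else [])) acc).getD r false =
        xor (BB.getD r false) (L.foldl (fun b c => xor b (ib.getD c false && TT.getD (c + r) false)) b0)) by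
    simpa using this (List.range ib.length) (BB.take N) false (by rw [List.getD_eq_getElem?_getD, List.getElem?_take_of_lt hr, Bool.xor_false, List.getD_eq_getElem?_getD])
  intro L
  induction L with
  | nil => intro acc b0 h; simpa using h
  | cons c L ih =>
    intro acc b0 h
    rw [List.foldl_cons, List.foldl_cons]
    apply ih
    rw [getD_xorStr, h]
    cases hb : ib.getD c false
    · simp
    · simp only [if_true, Bool.true_and]
      have e : ((TT.drop c).take N).getD r false = TT.getD (c + r) false := by
        rw [List.getD_eq_getElem?_getD, List.getElem?_take_of_lt hr, List.getElem?_drop, ← List.getD_eq_getElem?_getD]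
      rw [e]
      cases BB.getD r false <;> cases b0 <;> cases TT.getD (c + r) false <;> rfl

/-- The hit string has length `N` (when `|BB| ≥ N`). [folklore] -/
theorem length_hitStr (TT BB ib : List Bool) (N : ℕ) (hBB : N ≤ BB.length) :
    (hitStr TT BB ib N).length = N := by
  unfold hitStr
  suffices ∀ (L : List ℕ) (acc : List Bool), (∀ c ∈ L, c < ib.length) → acc.length = N →
      (L.foldl (fun acc c => xorStr acc (if ib.getD c false then (TT.drop c).take N else [])) acc).length = N from
    this _ _ (fun c hc => List.mem_range.1 hc) (by simp; omega)
  intro L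
  induction L with
  | nil => intro acc _ h; simpa using h
  | cons c L ih =>
    intro acc hL h
    rw [List.foldl_cons]
    apply ih _ (fun c' hc' => hL c' (List.mem_cons_of_mem _ hc'))
    rw [length_xorStr, h]
    split_ifs
    · simp only [List.length_take, List.length_drop]; omega
    · simp

/-! ### U7b. One block: design word, restriction of the seed, hit, xor, oracle -/

section Block

variable (e : List Bool) (Q : Polynomial ℕ)

/-- The block context `⟨⟨⟨X, TT⟩, ⟨BB, D⟩⟩, ⟨⟨U, P⟩, ⟨1ᴺ, 1ᵃ⟩⟩⟩`: the three parts of the seed, the design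
list code, the scale string `U = 1^{2^{t-1}}`, the pad, `N` and `a` in unary. [folklore] -/
def bCtx (X TT BB D U P : List Bool) (N a : ℕ) : List Bool :=
  boolPair (boolPair (boolPair X TT) (boolPair BB D)) (boolPair (boolPair U P) (boolPair (ones N) (ones a)))

/-- The index bits brick on `⟨ctx, 1ⁱ⟩`: `natBits (a+1) i`. [folklore] -/
def ibF : List Bool → List Bool :=
  fstF ∘ padTakeFn ∘ fanoutFn ((fun w => w ++ [true]) ∘ sndF ∘ sndF ∘ sndF ∘ fstF) (lenBinF ∘ sndF)

/-- `ibF ∈ FP`. [folklore] -/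
theorem ibF_mem_FP : ibF ∈ FP :=
  comp_mem_FP fstF_mem_FP (comp_mem_FP padTakeFn_mem_FP (fanoutFn_mem_FP
    (comp_mem_FP (append_mem_FP (PolyTimeComputable.id _) (const_mem_FP _)) (comp_mem_FP sndF_mem_FP (comp_mem_FP sndF_mem_FP (comp_mem_FP sndF_mem_FP fstF_mem_FP))))
    (comp_mem_FP lenBinF_mem_FP sndF_mem_FP)))

/-- Value of the index bits brick (`i < 2^{a+1}`). [folklore] -/
theorem ibF_apply (X TT BB D U P : List Bool) (N a : ℕ) {i : ℕ} (hi : i < 2 ^ (a + 1)) :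
    ibF (boolPair (bCtx X TT BB D U P N a) (ones i)) = natBits (a + 1) i := by
  simp only [ibF, Function.comp_apply, fanoutFn_apply, bCtx, fstF_boolPair, sndF_boolPair, lenBinF_apply, padTakeFn_boolPair,
    List.length_append, ones, List.length_replicate, List.length_singleton]
  exact PRGDerand.takeD_encodeNat_eq_natBits hi

/-- The hit brick in context: `hitF ⟨⟨TT, BB⟩, ⟨ib, 1ᴺ⟩⟩`. [folklore] -/
def hitCF : List Bool → List Bool :=
  hitF ∘ fanoutFn (fanoutFn (sndF ∘ fstF ∘ fstF ∘ fstF) (fstF ∘ sndF ∘ fstF ∘ fstF)) (fanoutFn ibF (fstF ∘ sndF ∘ sndF ∘ fstF))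

/-- `hitCF ∈ FP`. [folklore] -/
theorem hitCF_mem_FP : hitCF ∈ FP :=
  comp_mem_FP hitF_mem_FP (fanoutFn_mem_FP
    (fanoutFn_mem_FP (comp_mem_FP sndF_mem_FP (comp_mem_FP fstF_mem_FP (comp_mem_FP fstF_mem_FP fstF_mem_FP)))
      (comp_mem_FP fstF_mem_FP (comp_mem_FP sndF_mem_FP (comp_mem_FP fstF_mem_FP fstF_mem_FP))))
    (fanoutFn_mem_FP ibF_mem_FP (comp_mem_FP fstF_mem_FP (comp_mem_FP sndF_mem_FP (comp_mem_FP sndF_mem_FP fstF_mem_FP)))))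

/-- Value of the hit brick in context. [folklore] -/
theorem hitCF_apply (X TT BB D U P : List Bool) (N a : ℕ) {i : ℕ} (hi : i < 2 ^ (a + 1)) :
    hitCF (boolPair (bCtx X TT BB D U P N a) (ones i)) = hitStr TT BB (natBits (a + 1) i) N := by
  rw [hitCF, Function.comp_apply, fanoutFn_apply, fanoutFn_apply, fanoutFn_apply, ibF_apply X TT BB D U P N a hi]
  simp only [Function.comp_apply, bCtx, fstF_boolPair, sndF_boolPair]
  exact hitF_apply TT BB _ N

/-- The restriction brick in context: `resF ⟨gᵢ, ⟨U, X⟩⟩`, `gᵢ` the `i`-th design word. [folklore] -/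
def xsCF : List Bool → List Bool :=
  NWMachine.resF (2 * q) (4 * q) ∘ fanoutFn (HashBricks.nthItemFn ∘ fanoutFn sndF (sndF ∘ sndF ∘ fstF ∘ fstF))
    (fanoutFn (fstF ∘ fstF ∘ sndF ∘ fstF) (fstF ∘ fstF ∘ fstF ∘ fstF))

/-- `xsCF ∈ FP`. [folklore] -/
theorem xsCF_mem_FP : xsCF q ∈ FP :=
  comp_mem_FP (NWMachine.resF_mem_FP _ _) (fanoutFn_mem_FP
    (comp_mem_FP HashBricks.nthItemFn_mem_FP (fanoutFn_mem_FP sndF_mem_FP (comp_mem_FP sndF_mem_FP (comp_mem_FP sndF_mem_FP (comp_mem_FP fstF_mem_FP fstF_mem_FP)))))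
    (fanoutFn_mem_FP (comp_mem_FP fstF_mem_FP (comp_mem_FP fstF_mem_FP (comp_mem_FP sndF_mem_FP fstF_mem_FP)))
      (comp_mem_FP fstF_mem_FP (comp_mem_FP fstF_mem_FP (comp_mem_FP fstF_mem_FP fstF_mem_FP)))))

/-- Value of the restriction brick (`U = 1^{M}`, block length `2q · t(M)`). [folklore] -/
theorem xsCF_apply (X TT BB P : List Bool) (Dl : List (List Bool)) (M N a i : ℕ) :
    xsCF q (boolPair (bCtx X TT BB (encList Dl) (ones M) P N a) (ones i)) =
      NWMachine.resStr (4 * q) (2 * q * NWMachine.tOf M) (Dl.getD i []) X := by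
  rw [xsCF, Function.comp_apply, fanoutFn_apply, fanoutFn_apply]
  simp only [Function.comp_apply, bCtx, fstF_boolPair, sndF_boolPair, fanoutFn_apply, NWMachine.nthItemFn_encList]
  exact NWMachine.resF_apply (2 * q) (4 * q) _ X M

/-- **The block piece** on `⟨ctx, 1ⁱ⟩`: the oracle's answer on `xsᵢ ⊕ hitᵢ`. [folklore] -/
def blockPieceF : List Bool → List Bool :=
  NWMachine.evalF e Q ∘ fanoutFn (HardLangM.xorF ∘ fanoutFn (xsCF q) hitCF) (fanoutFn (sndF ∘ fstF ∘ sndF ∘ fstF) fun _ => [])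

/-- `blockPieceF ∈ FP`. [folklore] -/
theorem blockPieceF_mem_FP : blockPieceF q e Q ∈ FP :=
  comp_mem_FP (NWMachine.evalF_mem_FP e Q) (fanoutFn_mem_FP (comp_mem_FP HardLangM.xorF_mem_FP (fanoutFn_mem_FP (xsCF_mem_FP q) hitCF_mem_FP))
    (fanoutFn_mem_FP (comp_mem_FP sndF_mem_FP (comp_mem_FP fstF_mem_FP (comp_mem_FP sndF_mem_FP fstF_mem_FP))) (const_mem_FP _)))

/-- The block piece is at most one symbol. [folklore] -/
theorem length_blockPieceF_le (z : List Bool) : (blockPieceF q e Q z).length ≤ 1 := by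
  unfold blockPieceF; rw [Function.comp_apply]; exact NWMachine.length_evalF_le e Q _

/-- The block input string (the model). [folklore] -/
def inpStr (X TT BB : List Bool) (Dl : List (List Bool)) (M N a i : ℕ) : List Bool :=
  xorStr (NWMachine.resStr (4 * q) (2 * q * NWMachine.tOf M) (Dl.getD i []) X) (hitStr TT BB (natBits (a + 1) i) N)

/-- **Value of the block piece**, given the oracle's answers within budget `Q(|P|)`. [folklore] -/
theorem blockPieceF_apply (X TT BB : List Bool) (Dl : List (List Bool)) (M N a R : ℕ) {i : ℕ} (hi : i < 2 ^ (a + 1))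
    (G : List Bool → Bool) (hrun : ClockedUS.run (boolPair e (inpStr q X TT BB Dl M N a i)) (Q.eval R) = some [G (inpStr q X TT BB Dl M N a i)]) :
    blockPieceF q e Q (boolPair (bCtx X TT BB (encList Dl) (ones M) (ones R) N a) (ones i)) = [G (inpStr q X TT BB Dl M N a i)] := by
  rw [blockPieceF, Function.comp_apply, fanoutFn_apply, fanoutFn_apply, Function.comp_apply, fanoutFn_apply,
    xsCF_apply, hitCF_apply _ _ _ _ _ _ _ _ hi, HardLangM.xorF_apply]
  simp only [Function.comp_apply, bCtx, fstF_boolPair, sndF_boolPair]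
  exact NWMachine.evalF_apply e Q hrun

end Block

/-! ### U8. The amplified bit: the xor of the `K = 2ᵃ` block answers -/

section Amp

variable (e : List Bool) (Q : Polynomial ℕ)

/-- The block count numeral `⟦2ᵃ⟧` from the context. [folklore] -/
def kNumF : List Bool → List Bool := (fun w => Kannan.zerosFn w ++ [true]) ∘ sndF ∘ sndF ∘ sndF

/-- `kNumF ∈ FP`. [folklore] -/
theorem kNumF_mem_FP : kNumF ∈ FP :=
  comp_mem_FP (append_mem_FP Kannan.zerosFn_mem_FP (const_mem_FP _)) (comp_mem_FP sndF_mem_FP (comp_mem_FP sndF_mem_FP sndF_mem_FP))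

/-- Value of the block count numeral. [folklore] -/
theorem kNumF_apply (X TT BB D U P : List Bool) (N a : ℕ) : kNumF (bCtx X TT BB D U P N a) = encodeNat (2 ^ a) := by
  simp only [kNumF, Function.comp_apply, bCtx, sndF_boolPair, Kannan.zerosFn_apply, ones, List.length_replicate]
  exact HardLangM.zeros_append_true_eq_encodeNat a

/-- **The amplified-bit brick** on the block context: the xor of the `2ᵃ` block answers. [folklore] -/
def ampF : List Bool → List Bool :=
  sndPow 2 ∘ foldLoop HardLangM.xorF (clipF 1 (blockPieceF q e Q)) X ∘
    fanoutFn (fun w => w) (fanoutFn kNumF (fanoutFn (fun _ => []) fun _ => [false]))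

/-- `ampF ∈ FP`. [folklore] -/
theorem ampF_mem_FP : ampF q e Q ∈ FP :=
  comp_mem_FP (sndPow_mem_FP 2) (comp_mem_FP
    (foldLoop_clipF_mem_FP 1 HardLangM.xorF_mem_FP HardLangM.length_xorF_le (blockPieceF_mem_FP q e Q) _)
    (fanoutFn_mem_FP (PolyTimeComputable.id _) (fanoutFn_mem_FP kNumF_mem_FP (fanoutFn_mem_FP (const_mem_FP _) (const_mem_FP _)))))

/-- Folding xors of single bits. [folklore] -/
theorem foldl_xorStr_singleton (v : ℕ → Bool) : ∀ (L : List ℕ) (b : Bool),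
    L.foldl (fun acc j => xorStr acc [v j]) [b] = [L.foldl (fun b j => xor b (v j)) b]
  | [], b => rfl
  | j :: L, b => by rw [List.foldl_cons, List.foldl_cons]; exact foldl_xorStr_singleton v L _

/-- **Value of the amplified-bit brick** (`2ᵃ ≤ R = |P|`, oracle answering `G` on all block inputs). [folklore] -/
theorem ampF_apply (Xs TT BB : List Bool) (Dl : List (List Bool)) (M N a R : ℕ) (hR : 2 ^ a ≤ R) (G : List Bool → Bool)
    (hrun : ∀ i, i < 2 ^ a → ClockedUS.run (boolPair e (inpStr q Xs TT BB Dl M N a i)) (Q.eval R) = some [G (inpStr q Xs TT BB Dl M N a i)]) :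
    ampF q e Q (bCtx Xs TT BB (encList Dl) (ones M) (ones R) N a) =
      [(List.range (2 ^ a)).foldl (fun b i => xor b (G (inpStr q Xs TT BB Dl M N a i))) false] := by
  set ctx := bCtx Xs TT BB (encList Dl) (ones M) (ones R) N a with hctx
  have hk : 2 ^ a ≤ (X : Polynomial ℕ).eval ctx.length := by
    simp only [eval_X, hctx, bCtx, length_boolPair, ones, List.length_replicate]; omega
  have hloop := foldLoop_apply HardLangM.xorF (clipF 1 (blockPieceF q e Q)) hk 0 [false]
  rw [show ones 0 = ([] : List Bool) from rfl] at hloop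
  simp only [ampF, Function.comp_apply, fanoutFn_apply]
  rw [kNumF_apply, hloop, sndPow_succ_boolPair, sndPow_succ_boolPair, sndPow_zero_boolPair,
    foldAcc_clipF (fun j _ _ => (length_blockPieceF_le q e Q _).trans (by omega)),
    HardLangM.foldAcc_eq_foldl HardLangM.xorF (blockPieceF q e Q) ctx (fun a b => xorStr a b)
      (fun i => [G (inpStr q Xs TT BB Dl M N a i)]) _ _ _
      (fun a j _ _ => HardLangM.xorF_apply _ _) (fun j _ hj => by
        rw [hctx]; exact blockPieceF_apply q e Q Xs TT BB Dl M N a R (lt_of_lt_of_le (by omega) (Nat.pow_le_pow_right (by norm_num) (Nat.le_succ a))) G (hrun j (by omega))),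
    ← List.range_eq_range']
  exact foldl_xorStr_singleton _ _ _

end Amp

/-! ### U9. The top level: parameters, parsing, the design, the size test -/

section Top

variable (e : List Bool) (Q : Polynomial ℕ)

/-- The scale `1ᵗ` of the payload. [folklore] -/
def cT : List Bool → List Bool := scaleOfF q ∘ fstF
/-- `1ᴺ`. [folklore] -/
def cN : List Bool → List Bool := uNF q ∘ cT q
/-- `1ᵃ`. [folklore] -/
def cA : List Bool → List Bool := uAF q ∘ cT q
/-- `1ᵐ`. [folklore] -/
def cM : List Bool → List Bool := uMF q ∘ cT q
/-- `1ᵈ`. [folklore] -/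
def cD : List Bool → List Bool := uDF q ∘ cT q
/-- The `x`-part of the seed: `x[0, d)`. [folklore] -/
def cX : List Bool → List Bool := takeFn ∘ fanoutFn (cD q) fstF
/-- The Hankel vector: `x[d, d + N + m)`. [folklore] -/
def cTT : List Bool → List Bool := takeFn ∘ fanoutFn (appF ∘ fanoutFn (cN q) (cM q)) (dropFn ∘ fanoutFn (cD q) fstF)
/-- The shift: `x[d + N + m, d + N + m + N)`. [folklore] -/
def cBB : List Bool → List Bool :=
  takeFn ∘ fanoutFn (cN q) (dropFn ∘ fanoutFn (appF ∘ fanoutFn (cD q) (appF ∘ fanoutFn (cN q) (cM q))) fstF)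
/-- The scale string `U = 1^{2^{t-1}}` (bounded by the pad). [folklore] -/
def cU : List Bool → List Bool :=
  binToUnaryFn ∘ fanoutFn sndF ((fun w => Kannan.zerosFn w ++ [true]) ∘ dropFn ∘ fanoutFn (fun _ => [true]) (cT q))
/-- The design list code. [folklore] -/
def cDes : List Bool → List Bool := NWMachine.designF (2 * q) (4 * q) ∘ fanoutFn (cU q) fun _ => []
/-- `1^{K-1}`, `K = 2ᵃ` (bounded by the pad). [folklore] -/
def cK1 : List Bool → List Bool :=
  dropFn ∘ fanoutFn (fun _ => [true]) (binToUnaryFn ∘ fanoutFn sndF ((fun w => Kannan.zerosFn w ++ [true]) ∘ cA q))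
/-- The last needed design word (empty iff the design is too short). [folklore] -/
def lastWordF : List Bool → List Bool := HashBricks.nthItemFn ∘ fanoutFn (cK1 q) (cDes q)
/-- The block context. [folklore] -/
def ctxF : List Bool → List Bool :=
  fanoutFn (fanoutFn (fanoutFn (cX q) (cTT q)) (fanoutFn (cBB q) (cDes q))) (fanoutFn (fanoutFn (cU q) sndF) (fanoutFn (cN q) (cA q)))

/-- The top-level bricks are in `FP`. [folklore] -/
theorem cBricks_mem_FP : cT q ∈ FP ∧ cN q ∈ FP ∧ cA q ∈ FP ∧ cM q ∈ FP ∧ cD q ∈ FP ∧ cX q ∈ FP ∧ cTT q ∈ FP ∧ cBB q ∈ FP ∧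
    cU q ∈ FP ∧ cDes q ∈ FP ∧ cK1 q ∈ FP ∧ lastWordF q ∈ FP ∧ ctxF q ∈ FP := by
  obtain ⟨hN, -, hA, hM, hD, -⟩ := uBricks_mem_FP q
  have hT : cT q ∈ FP := comp_mem_FP (scaleOfF_mem_FP q) fstF_mem_FP
  have hcN : cN q ∈ FP := comp_mem_FP hN hT
  have hcA : cA q ∈ FP := comp_mem_FP hA hT
  have hcM : cM q ∈ FP := comp_mem_FP hM hT
  have hcD : cD q ∈ FP := comp_mem_FP hD hT
  have hcX : cX q ∈ FP := comp_mem_FP takeFn_mem_FP (fanoutFn_mem_FP hcD fstF_mem_FP)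
  have hNM : (appF ∘ fanoutFn (cN q) (cM q)) ∈ FP := comp_mem_FP appF_mem_FP (fanoutFn_mem_FP hcN hcM)
  have hcTT : cTT q ∈ FP := comp_mem_FP takeFn_mem_FP (fanoutFn_mem_FP hNM (comp_mem_FP dropFn_mem_FP (fanoutFn_mem_FP hcD fstF_mem_FP)))
  have hcBB : cBB q ∈ FP := comp_mem_FP takeFn_mem_FP (fanoutFn_mem_FP hcN (comp_mem_FP dropFn_mem_FP (fanoutFn_mem_FP
    (comp_mem_FP appF_mem_FP (fanoutFn_mem_FP hcD hNM)) fstF_mem_FP)))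
  have hzt : (fun w : List Bool => Kannan.zerosFn w ++ [true]) ∈ FP := append_mem_FP Kannan.zerosFn_mem_FP (const_mem_FP _)
  have hcU : cU q ∈ FP := comp_mem_FP binToUnaryFn_mem_FP (fanoutFn_mem_FP sndF_mem_FP (comp_mem_FP hzt (comp_mem_FP dropFn_mem_FP
    (fanoutFn_mem_FP (const_mem_FP _) hT))))
  have hcDes : cDes q ∈ FP := comp_mem_FP (NWMachine.designF_mem_FP _ _) (fanoutFn_mem_FP hcU (const_mem_FP _))
  have hcK1 : cK1 q ∈ FP := comp_mem_FP dropFn_mem_FP (fanoutFn_mem_FP (const_mem_FP _) (comp_mem_FP binToUnaryFn_mem_FP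
    (fanoutFn_mem_FP sndF_mem_FP (comp_mem_FP hzt hcA))))
  have hLW : lastWordF q ∈ FP := comp_mem_FP HashBricks.nthItemFn_mem_FP (fanoutFn_mem_FP hcK1 hcDes)
  exact ⟨hT, hcN, hcA, hcM, hcD, hcX, hcTT, hcBB, hcU, hcDes, hcK1, hLW,
    fanoutFn_mem_FP (fanoutFn_mem_FP (fanoutFn_mem_FP hcX hcTT) (fanoutFn_mem_FP hcBB hcDes))
      (fanoutFn_mem_FP (fanoutFn_mem_FP hcU sndF_mem_FP) (fanoutFn_mem_FP hcN hcA))⟩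

/-- The raw core on `⟨x, P⟩`: `0` at scale `0` or if the design is too short, else the amplified bit. [folklore] -/
def coreF0 : List Bool → List Bool :=
  iteFn (isNilFn ∘ cT q) (fun _ => [false]) (iteFn (isNilFn ∘ lastWordF q) (fun _ => [false]) (ampF q e Q ∘ ctxF q))

/-- **The core decision function** (the raw core compared with `[1]`, so that the output is one bit
on every input). [folklore] -/
def coreF : List Bool → List Bool := eqPairFn ∘ fanoutFn (coreF0 q e Q) fun _ => [true]

/-- `coreF ∈ FP`. [folklore] -/
theorem coreF_mem_FP : coreF0 q e Q ∈ FP ∧ coreF q e Q ∈ FP := by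
  obtain ⟨hT, -, -, -, -, -, -, -, -, -, -, hLW, hctx⟩ := cBricks_mem_FP q
  have h0 : coreF0 q e Q ∈ FP := iteFn_mem_FP (comp_mem_FP isNilFn_mem_FP hT) (const_mem_FP _)
    (iteFn_mem_FP (comp_mem_FP isNilFn_mem_FP hLW) (const_mem_FP _) (comp_mem_FP (ampF_mem_FP q e Q) hctx))
  exact ⟨h0, comp_mem_FP eqPairFn_mem_FP (fanoutFn_mem_FP h0 (const_mem_FP _))⟩

/-- The core is one bit on every input. [folklore] -/
theorem oneBit_coreF : OneBit (coreF q e Q) := fun w => by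
  rcases eqPairFn_eq_or (fanoutFn (coreF0 q e Q) (fun _ => [true]) w) with h | h <;> exact ⟨_, h⟩

/-- `a < seedLen`. [folklore] -/
theorem aOf_lt_seedLen (t : ℕ) : IWStrong.aOf q t < IWStrong.seedLen q t := by
  unfold IWStrong.seedLen IWStrong.mOf; omega

/-- `t(2^{t-1}) = t` for `t ≥ 1`. [folklore] -/
theorem tOf_two_pow_pred {t : ℕ} (ht : 1 ≤ t) : NWMachine.tOf (2 ^ (t - 1)) = t := by
  rw [NWMachine.tOf, Nat.log_pow (by norm_num)]; omega

/-- **Values of the top-level bricks** on `⟨x, P⟩` at a positive scale whose seed fits, with a pad of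
length `≥ 2^{|x|}`. [folklore] -/
theorem cBricks_apply (x P : List Bool) {t : ℕ} (ht : IWStrong.scaleOf q x.length = t) (ht1 : 1 ≤ t)
    (hseed : IWStrong.seedLen q t ≤ x.length) (hP : 2 ^ x.length ≤ P.length) :
    cT q (boolPair x P) = ones t ∧ cN q (boolPair x P) = ones (IWStrong.NOf q t) ∧ cA q (boolPair x P) = ones (IWStrong.aOf q t) ∧
    cM q (boolPair x P) = ones (IWStrong.mOf q t) ∧ cD q (boolPair x P) = ones (IWStrong.dOf q t) ∧
    cX q (boolPair x P) = x.take (IWStrong.dOf q t) ∧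
    cTT q (boolPair x P) = (x.drop (IWStrong.dOf q t)).take (IWStrong.NOf q t + IWStrong.mOf q t) ∧
    cBB q (boolPair x P) = (x.drop (IWStrong.dOf q t + (IWStrong.NOf q t + IWStrong.mOf q t))).take (IWStrong.NOf q t) ∧
    cU q (boolPair x P) = ones (2 ^ (t - 1)) ∧
    cDes q (boolPair x P) = encList (NWMachine.designStrs (2 * q) (4 * q) t) ∧
    cK1 q (boolPair x P) = ones (2 ^ IWStrong.aOf q t - 1) ∧
    lastWordF q (boolPair x P) = (NWMachine.designStrs (2 * q) (4 * q) t).getD (2 ^ IWStrong.aOf q t - 1) [] ∧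
    ctxF q (boolPair x P) = bCtx (x.take (IWStrong.dOf q t)) ((x.drop (IWStrong.dOf q t)).take (IWStrong.NOf q t + IWStrong.mOf q t))
      ((x.drop (IWStrong.dOf q t + (IWStrong.NOf q t + IWStrong.mOf q t))).take (IWStrong.NOf q t))
      (encList (NWMachine.designStrs (2 * q) (4 * q) t)) (ones (2 ^ (t - 1))) P (IWStrong.NOf q t) (IWStrong.aOf q t) := by
  obtain ⟨uN, -, uA, uM, uD, -⟩ := uBricks_apply q t
  have hT : cT q (boolPair x P) = ones t := by rw [cT, Function.comp_apply, fstF_boolPair, scaleOfF_apply, ht]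
  have hN : cN q (boolPair x P) = ones (IWStrong.NOf q t) := by rw [cN, Function.comp_apply, hT, uN]
  have hA : cA q (boolPair x P) = ones (IWStrong.aOf q t) := by rw [cA, Function.comp_apply, hT, uA]
  have hM : cM q (boolPair x P) = ones (IWStrong.mOf q t) := by rw [cM, Function.comp_apply, hT, uM]
  have hD : cD q (boolPair x P) = ones (IWStrong.dOf q t) := by rw [cD, Function.comp_apply, hT, uD]
  have hX : cX q (boolPair x P) = x.take (IWStrong.dOf q t) := by
    rw [cX, Function.comp_apply, fanoutFn_apply, hD, fstF_boolPair, takeFn_boolPair]; simp [ones]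
  have hTT : cTT q (boolPair x P) = (x.drop (IWStrong.dOf q t)).take (IWStrong.NOf q t + IWStrong.mOf q t) := by
    rw [cTT, Function.comp_apply, fanoutFn_apply, Function.comp_apply, fanoutFn_apply, hN, hM, Function.comp_apply, fanoutFn_apply, hD,
      fstF_boolPair, dropFn_boolPair, appF_boolPair, takeFn_boolPair]
    simp [ones]
  have hBB : cBB q (boolPair x P) = (x.drop (IWStrong.dOf q t + (IWStrong.NOf q t + IWStrong.mOf q t))).take (IWStrong.NOf q t) := by
    rw [cBB, Function.comp_apply, fanoutFn_apply, hN, Function.comp_apply, fanoutFn_apply, Function.comp_apply, fanoutFn_apply, hD,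
      Function.comp_apply, fanoutFn_apply, hN, hM, fstF_boolPair, appF_boolPair, appF_boolPair, dropFn_boolPair, takeFn_boolPair]
    simp [ones]
  have htx : t ≤ x.length := ht ▸ (Nat.findGreatest_le _ : IWStrong.scaleOf q x.length ≤ x.length)
  have hU : cU q (boolPair x P) = ones (2 ^ (t - 1)) := by
    rw [cU, Function.comp_apply, fanoutFn_apply, sndF_boolPair, Function.comp_apply, Function.comp_apply, fanoutFn_apply, hT,
      dropFn_boolPair, Kannan.zerosFn_apply]
    simp only [List.length_singleton, ones, List.drop_replicate, List.length_replicate, HardLangM.zeros_append_true_eq_encodeNat,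
      binToUnaryFn_boolPair, bitsToNat_encodeNat]
    rw [min_eq_left]
    exact (Nat.pow_le_pow_right (by norm_num) (by omega)).trans hP
  have hDes : cDes q (boolPair x P) = encList (NWMachine.designStrs (2 * q) (4 * q) t) := by
    rw [cDes, Function.comp_apply, fanoutFn_apply, hU, NWMachine.designF_apply, fstF_boolPair]
    simp only [ones, List.length_replicate, tOf_two_pow_pred ht1]
  have haP : 2 ^ IWStrong.aOf q t ≤ P.length :=
    (Nat.pow_le_pow_right (by norm_num) ((aOf_lt_seedLen q t).le.trans hseed)).trans hP
  have hK1 : cK1 q (boolPair x P) = ones (2 ^ IWStrong.aOf q t - 1) := by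
    rw [cK1, Function.comp_apply, fanoutFn_apply, Function.comp_apply, fanoutFn_apply, sndF_boolPair, Function.comp_apply, hA,
      Kannan.zerosFn_apply]
    simp only [ones, List.length_replicate, HardLangM.zeros_append_true_eq_encodeNat, binToUnaryFn_boolPair, bitsToNat_encodeNat,
      min_eq_left haP, dropFn_boolPair, List.length_singleton, List.drop_replicate]
  have hLW : lastWordF q (boolPair x P) = (NWMachine.designStrs (2 * q) (4 * q) t).getD (2 ^ IWStrong.aOf q t - 1) [] := by
    rw [lastWordF, Function.comp_apply, fanoutFn_apply, hK1, hDes, NWMachine.nthItemFn_encList]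
  refine ⟨hT, hN, hA, hM, hD, hX, hTT, hBB, hU, hDes, hK1, hLW, ?_⟩
  simp only [ctxF, fanoutFn_apply, hX, hTT, hBB, hDes, hU, sndF_boolPair, hN, hA]
  rfl

end Top

/-! ### V2. Semantics: the machine's block inputs are the inputs of `Amp` -/

section Semantics

variable (L₁ : Language Bool)

/-- `bz (a ⊕ b) = bz a + bz b`. [folklore] -/
theorem bz_xor (a b : Bool) : IWStrong.bz (xor a b) = IWStrong.bz a + IWStrong.bz b := by
  cases a <;> cases b <;> decide

/-- `bz (a ∧ b) = bz a · bz b`. [folklore] -/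
theorem bz_and (a b : Bool) : IWStrong.bz (a && b) = IWStrong.bz a * IWStrong.bz b := by
  cases a <;> cases b <;> decide

/-- A sum of bits in `𝔽₂` is the xor-fold. [folklore] -/
theorem sum_bz_eq_foldl (m : ℕ) (f : ℕ → Bool) :
    ∑ c : Fin m, IWStrong.bz (f c) = IWStrong.bz ((List.range m).foldl (fun b c => xor b (f c)) false) := by
  induction m with
  | zero => simp [IWStrong.bz]
  | succ m ih =>
    rw [Fin.sum_univ_castSucc, List.range_succ, List.foldl_append, List.foldl_cons, List.foldl_nil, bz_xor]
    simp only [Fin.val_castSucc, Fin.val_last]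
    rw [ih]

/-- The greedy code keeps at most one word per candidate. [folklore] -/
theorem length_lexicode_le {n b : ℕ} (d : ℕ) (cs : List (Fin n → Fin b)) : (lexicode d cs).length ≤ cs.length := by
  unfold lexicode
  suffices ∀ (acc : List (Fin n → Fin b)) (L : List (Fin n → Fin b)), (L.foldl (lexStep d) acc).length ≤ acc.length + L.length from
    by simpa using this [] cs
  intro acc L
  induction L generalizing acc with
  | nil => simp
  | cons c L ih =>
    rw [List.foldl_cons]
    refine (ih _).trans ?_
    unfold lexStep; split_ifs <;> simp; omega

/-- At scale `0` the strong bit is `0` (too few design words of length `0`). [folklore] -/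
theorem strongFn_zero (u : Fin (IWStrong.seedLen q 0) → Bool) : IWStrong.strongFn q L₁ 0 u = false := by
  unfold IWStrong.strongFn
  rw [dif_neg]
  intro h
  have h1 : (lexWords (IWStrong.NOf q 0) (IWStrong.bOf q) 0).length ≤ 1 := by
    unfold lexWords
    refine (length_lexicode_le _ _).trans ?_
    simp [cands, IWStrong.NOf]
  have h2 : 2 ^ 9 ≤ IWStrong.kOf q 0 := by
    unfold IWStrong.kOf IWStrong.aOf
    exact Nat.pow_le_pow_right (by norm_num) (by omega)
  omega

/-- Design words are nonempty strings at a positive scale (`q ≥ 1`). [folklore] -/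
theorem designStrs_getD_ne_nil (hq : 1 ≤ q) {t : ℕ} (ht : 1 ≤ t) {i : ℕ}
    (hi : i < (lexWords (IWStrong.NOf q t) (IWStrong.bOf q) t).length) :
    (NWMachine.designStrs (2 * q) (4 * q) t).getD i [] ≠ [] := by
  have hlen : ∀ g : Fin (2 * q * t) → Fin (2 ^ (4 * q)), (NWMachine.wordStr (4 * q) (2 * q * t) g).length = 4 * q * (2 * q * t) := fun g => by
    unfold NWMachine.wordStr; exact length_natBits _ _
  rw [NWMachine.designStrs_eq, List.getD_eq_getElem?_getD, List.getElem?_map]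
  have hi' : i < (lexWords (2 * q * t) (2 ^ (4 * q)) t).length := hi
  rw [List.getElem?_eq_getElem hi']
  simp only [Option.map_some, Option.getD_some]
  intro h
  have := congrArg List.length h
  rw [hlen] at this
  simp at this
  omega

/-- **The size test**: the last needed word is missing iff the design is too short. [folklore] -/
theorem lastWord_eq_nil_iff (hq : 1 ≤ q) {t : ℕ} (ht : 1 ≤ t) :
    (NWMachine.designStrs (2 * q) (4 * q) t).getD (2 ^ IWStrong.aOf q t - 1) [] = [] ↔
      ¬ IWStrong.kOf q t ≤ (lexWords (IWStrong.NOf q t) (IWStrong.bOf q) t).length := by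
  have hK : 1 ≤ IWStrong.kOf q t := Nat.one_le_two_pow
  unfold IWStrong.kOf at hK ⊢
  constructor
  · intro h hle
    exact designStrs_getD_ne_nil q hq ht (by omega) h
  · intro h
    rw [List.getD_eq_getElem?_getD, List.getElem?_eq_none]
    · rfl
    · rw [NWMachine.designStrs_eq, List.length_map]
      push Not at h
      exact Nat.le_sub_one_of_lt h

/-- `parityFin` is the xor-fold. [folklore] -/
theorem parityFin_eq_foldl : ∀ (k : ℕ) (z : Fin k → Bool),
    parityFin k z = (List.range k).foldl (fun b i => xor b (if h : i < k then z ⟨i, h⟩ else false)) false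
  | 0, z => by simp [parityFin]
  | k + 1, z => by
    rw [parityFin, List.range_succ, List.foldl_append, List.foldl_cons, List.foldl_nil, parityFin_eq_foldl k]
    simp only [dif_pos (Nat.lt_succ_self k)]
    congr 1
    · apply List.foldl_ext
      intro b i hi
      rw [List.mem_range] at hi
      simp [hi, Nat.lt_succ_of_lt hi]

variable {q}

/-- **The block input of the machine is the block input of `Amp`.** [folklore] -/
theorem ofFn_inp_eq_inpStr {t : ℕ} (ht : 1 ≤ t) (x : List Bool) (hseed : IWStrong.seedLen q t ≤ x.length)
    (hdes : IWStrong.kOf q t ≤ (lexWords (IWStrong.NOf q t) (IWStrong.bOf q) t).length) (i : Fin (IWStrong.kOf q t)) :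
    List.ofFn (IWAmp.inp (iwBlocks (IWStrong.NOf q t) (IWStrong.bOf q) t (IWStrong.kOf q t) hdes) (IWStrong.idxOf q t) i
        (IWStrong.parseSeed q t fun j => x.get (Fin.castLE hseed j))) =
      inpStr q (x.take (IWStrong.dOf q t)) ((x.drop (IWStrong.dOf q t)).take (IWStrong.NOf q t + IWStrong.mOf q t))
        ((x.drop (IWStrong.dOf q t + (IWStrong.NOf q t + IWStrong.mOf q t))).take (IWStrong.NOf q t))
        (NWMachine.designStrs (2 * q) (4 * q) t) (2 ^ (t - 1)) (IWStrong.NOf q t) (IWStrong.aOf q t) i := by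
  set N := IWStrong.NOf q t with hN
  set d := IWStrong.dOf q t with hd
  set m := IWStrong.mOf q t with hm
  set Xs := x.take d with hXs
  set TT := (x.drop d).take (N + m) with hTT
  set BB := (x.drop (d + (N + m))).take N with hBB
  have hsl : IWStrong.seedLen q t = d + ((N + m) + N) := rfl
  have hXl : Xs.length = d := by rw [hXs, List.length_take]; omega
  have hBBl : BB.length = N := by rw [hBB, List.length_take, List.length_drop]; omega
  have hTTl : TT.length = N + m := by rw [hTT, List.length_take, List.length_drop]; omega
  have hdNb : d = N * IWStrong.bOf q := rfl
  -- the design word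
  have hword : (NWMachine.designStrs (2 * q) (4 * q) t).getD i [] =
      NWMachine.wordStr (4 * q) N (lexDesignWords N (IWStrong.bOf q) t (IWStrong.kOf q t) hdes i) :=
    NWMachine.getD_designStrs (a := 2 * q) (β := 4 * q) (t := t) hdes i
  have htOf : 2 * q * NWMachine.tOf (2 ^ (t - 1)) = N := by rw [tOf_two_pow_pred ht]; rfl
  -- the restriction
  have hres : NWMachine.resStr (4 * q) (2 * q * NWMachine.tOf (2 ^ (t - 1))) ((NWMachine.designStrs (2 * q) (4 * q) t).getD i []) Xs =
      List.ofFn fun r : Fin N => Xs.getD (2 ^ (4 * q) * r + lexDesignWords N (IWStrong.bOf q) t (IWStrong.kOf q t) hdes i r) false := by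
    rw [htOf, hword]
    exact NWMachine.resStr_wordStr _ Xs (by rw [hXl, hdNb]; unfold IWStrong.bOf; rw [mul_comm])
  -- lengths
  have hlenR : (inpStr q Xs TT BB (NWMachine.designStrs (2 * q) (4 * q) t) (2 ^ (t - 1)) N (IWStrong.aOf q t) i).length = N := by
    unfold inpStr
    rw [length_xorStr, hres, List.length_ofFn, length_hitStr _ _ _ _ hBBl.ge, max_self]
  apply List.ext_getElem (by rw [List.length_ofFn, hlenR])
  intro r h1 h2
  rw [List.length_ofFn] at h1
  rw [List.getElem_ofFn]
  -- compare via `getD`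
  have hget : ∀ (l : List Bool) (hr : r < l.length), l[r] = l.getD r false := fun l hr => by
    rw [List.getD_eq_getElem?_getD, List.getElem?_eq_getElem hr]; rfl
  rw [hget _ h2]
  unfold inpStr
  rw [getD_xorStr, hres, getD_hitStr _ _ _ _ h1]
  -- the `x`-part through the block
  have hu : ∀ (j : Fin (IWStrong.seedLen q t)), (fun j => x.get (Fin.castLE hseed j)) j = x.getD j false := fun j => by
    simp [List.getD_eq_getElem?_getD, List.getElem?_eq_getElem (lt_of_lt_of_le j.isLt hseed)]
  have lhs1 : (IWStrong.parseSeed q t fun j => x.get (Fin.castLE hseed j)).1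
      (iwBlocks N (IWStrong.bOf q) t (IWStrong.kOf q t) hdes i ⟨r, h1⟩) =
      Xs.getD (2 ^ (4 * q) * r + lexDesignWords N (IWStrong.bOf q) t (IWStrong.kOf q t) hdes i ⟨r, h1⟩) false := by
    simp only [IWStrong.parseSeed, hu]
    have hv : ((IWStrong.sidx q t) (Sum.inl (iwBlocks N (IWStrong.bOf q) t (IWStrong.kOf q t) hdes i ⟨r, h1⟩)) : ℕ) =
        (lexDesignWords N (IWStrong.bOf q) t (IWStrong.kOf q t) hdes i ⟨r, h1⟩ : ℕ) + IWStrong.bOf q * r := by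
      simp only [IWStrong.sidx, iwBlocks, lexDesign, graphBlock, Equiv.trans_apply, Equiv.sumCongr_apply, Sum.map_inl, Equiv.refl_apply,
        Function.Embedding.trans_apply, Equiv.toEmbedding_apply, Function.Embedding.coeFn_mk]
      rfl
    rw [hv, hXs, List.getD_eq_getElem?_getD, List.getD_eq_getElem?_getD, List.getElem?_take_of_lt]
    · congr 2; unfold IWStrong.bOf; ring
    · change _ < N * IWStrong.bOf q
      have := (lexDesignWords N (IWStrong.bOf q) t (IWStrong.kOf q t) hdes i ⟨r, h1⟩).isLt
      unfold IWStrong.bOf at this ⊢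
      nlinarith
  -- the hitter bit
  have lhs2 : IWAmp.hitB (IWStrong.idxOf q t) (IWStrong.parseSeed q t fun j => x.get (Fin.castLE hseed j)).2 i ⟨r, h1⟩ =
      xor (BB.getD r false) ((List.range (natBits (IWStrong.aOf q t + 1) i).length).foldl
        (fun b c => xor b ((natBits (IWStrong.aOf q t + 1) i).getD c false && TT.getD (c + r) false)) false) := by
    rw [length_natBits]
    have hm1 : IWStrong.aOf q t + 1 = m := rfl
    rw [hm1]
    -- both sides as `bz _ ≠ 0`
    unfold IWAmp.hitB Hankel.gen Hankel.mulVec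
    simp only [IWStrong.parseSeed, hu, Pi.add_apply]
    have hT : ∀ c : Fin m, (((IWStrong.sidx q t) (Sum.inr (Sum.inl (⟨r + c, by omega⟩ : Fin (N + m))))) : ℕ) = d + (r + c) := fun c => by
      simp only [IWStrong.sidx, Equiv.trans_apply, Equiv.sumCongr_apply, Sum.map_inr]
      rfl
    have hB : (((IWStrong.sidx q t) (Sum.inr (Sum.inr (⟨r, h1⟩ : Fin N)))) : ℕ) = d + ((N + m) + r) := by
      simp only [IWStrong.sidx, Equiv.trans_apply, Equiv.sumCongr_apply, Sum.map_inr]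
      rfl
    have hidx : ∀ c : Fin m, IWStrong.idxOf q t i c = IWStrong.bz ((natBits m i).getD c false) := fun c => by
      rw [getD_natBits]; simp [IWStrong.idxOf, IWStrong.bz, c.isLt]
    simp only [hT, hB, hidx, ← bz_and]
    have hTT' : ∀ c : Fin m, x.getD (d + (r + c)) false = TT.getD (c + r) false := fun c => by
      rw [hTT, List.getD_eq_getElem?_getD, List.getD_eq_getElem?_getD, List.getElem?_take_of_lt (by omega), List.getElem?_drop]
      congr 2; ring
    have hBB' : x.getD (d + ((N + m) + r)) false = BB.getD r false := by
      rw [hBB, List.getD_eq_getElem?_getD, List.getD_eq_getElem?_getD, List.getElem?_take_of_lt h1, List.getElem?_drop]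
      simp only [Nat.add_assoc]
    simp only [hTT', hBB']
    rw [show (∑ c : Fin m, IWStrong.bz (TT.getD ((c : ℕ) + r) false && (natBits m i).getD c false)) =
        ∑ c : Fin m, IWStrong.bz ((fun c : ℕ => (natBits m i).getD c false && TT.getD (c + r) false) c) from
      Finset.sum_congr rfl fun c _ => by rw [Bool.and_comm],
      sum_bz_eq_foldl m (fun c => (natBits m i).getD c false && TT.getD (c + r) false), ← bz_xor, Bool.xor_comm]
    simp only [IWStrong.bz_ne_zero]
    cases ((BB.getD r false) ^^ List.foldl (fun b c => b ^^ ((natBits m i).getD c false && TT.getD (c + r) false)) false (List.range m)) <;> simp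
  -- assemble
  show xor _ _ = _
  rw [lhs2]
  congr 1
  have hof : ∀ (F : Fin N → Bool), (List.ofFn F).getD r false = F ⟨r, h1⟩ := fun F => by
    rw [List.getD_eq_getElem?_getD, List.getElem?_ofFn, dif_pos h1]
    rfl
  rw [hof, lhs1]

end Semantics

/-! ### The value of the core, and the language is in `E` -/

section Value

variable (e : List Bool) (Q : Polynomial ℕ) (L₁ : Language Bool)

/-- The block input has length `≤ N`. [folklore] -/
theorem length_inpStr_le (Xs TT BB : List Bool) (Dl : List (List Bool)) {t : ℕ} (ht : 1 ≤ t) (N a i : ℕ) (hBB : BB.length = N) :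
    (inpStr q Xs TT BB Dl (2 ^ (t - 1)) N a i).length ≤ max (2 * q * t) N := by
  unfold inpStr
  rw [length_xorStr, tOf_two_pow_pred ht, length_hitStr _ _ _ _ hBB.ge]
  exact max_le_max (NWMachine.length_resStr_le _ _ _ _) le_rfl

/-- `isNilFn (1ᵗ) = [t = 0]`. [folklore] -/
theorem isNilFn_ones (t : ℕ) : isNilFn (ones t) = [decide (t = 0)] := by
  cases t <;> simp [isNilFn, ones, List.replicate_succ]

/-- **Value of the core at a positive scale with enough design words.** [folklore] -/
theorem coreF_apply_pos (x : List Bool) {R t : ℕ} (ht : IWStrong.scaleOf q x.length = t) (ht1 : 1 ≤ t)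
    (hseed : IWStrong.seedLen q t ≤ x.length) (hR : 2 ^ x.length ≤ R)
    (hdes : IWStrong.kOf q t ≤ (lexWords (IWStrong.NOf q t) (IWStrong.bOf q) t).length)
    (hrun : ∀ u : List Bool, u.length ≤ x.length → ClockedUS.run (boolPair e u) (Q.eval R) = some [L₁.boolIndicator u]) :
    ampF q e Q (ctxF q (boolPair x (ones R))) = [IWStrong.strongFn q L₁ t fun j => x.get (Fin.castLE hseed j)] := by
  have hctx := (cBricks_apply q x (ones R) ht ht1 hseed (by simp only [ones, List.length_replicate]; exact hR)).2.2.2.2.2.2.2.2.2.2.2.2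
  rw [hctx]
  have hsl : IWStrong.seedLen q t = IWStrong.dOf q t + ((IWStrong.NOf q t + IWStrong.mOf q t) + IWStrong.NOf q t) := rfl
  have hBBl : ((x.drop (IWStrong.dOf q t + (IWStrong.NOf q t + IWStrong.mOf q t))).take (IWStrong.NOf q t)).length = IWStrong.NOf q t := by
    rw [List.length_take, List.length_drop]; omega
  have haR : 2 ^ IWStrong.aOf q t ≤ R := (Nat.pow_le_pow_right (by norm_num) ((aOf_lt_seedLen q t).le.trans hseed)).trans hR
  have hN2 : IWStrong.NOf q t = 2 * q * t := rfl
  have hNx : max (2 * q * t) (IWStrong.NOf q t) ≤ x.length := by omega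
  rw [ampF_apply q e Q _ _ _ _ _ (IWStrong.NOf q t) (IWStrong.aOf q t) R haR L₁.boolIndicator fun i _ =>
    hrun _ ((length_inpStr_le q _ _ _ _ ht1 (IWStrong.NOf q t) _ i hBBl).trans hNx)]
  -- compare with `Amp`
  unfold IWStrong.strongFn
  rw [dif_pos hdes, IWAmp.amp, parityFin_eq_foldl]
  have key : ∀ (b : Bool) (i : ℕ), i ∈ List.range (IWStrong.kOf q t) →
      xor b (L₁.boolIndicator (inpStr q (x.take (IWStrong.dOf q t)) ((x.drop (IWStrong.dOf q t)).take (IWStrong.NOf q t + IWStrong.mOf q t))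
        ((x.drop (IWStrong.dOf q t + (IWStrong.NOf q t + IWStrong.mOf q t))).take (IWStrong.NOf q t))
        (NWMachine.designStrs (2 * q) (4 * q) t) (2 ^ (t - 1)) (IWStrong.NOf q t) (IWStrong.aOf q t) i)) =
      xor b (if h : i < IWStrong.kOf q t then (L₁.sliceFn (IWStrong.NOf q t))
        (IWAmp.inp (iwBlocks (IWStrong.NOf q t) (IWStrong.bOf q) t (IWStrong.kOf q t) hdes) (IWStrong.idxOf q t) ⟨i, h⟩
          (IWStrong.parseSeed q t fun j => x.get (Fin.castLE hseed j))) else false) := by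
    intro b i hi
    rw [List.mem_range] at hi
    rw [dif_pos hi]
    unfold Language.sliceFn
    rw [ofFn_inp_eq_inpStr ht1 x hseed hdes ⟨i, hi⟩]
  exact congrArg (fun b => [b]) (List.foldl_ext _ _ _ key)

/-- **Value of the core**: the strong bit of the payload, given that the coded machine `e` answers
membership in `L₁` within budget `Q(R)` on all strings of length `≤ |x|`, `R ≥ 2^{|x|}`. [folklore] -/
theorem coreF_apply (hq : 1 ≤ q) (x : List Bool) {R : ℕ} (hR : 2 ^ x.length ≤ R)
    (hrun : ∀ u : List Bool, u.length ≤ x.length → ClockedUS.run (boolPair e u) (Q.eval R) = some [L₁.boolIndicator u]) :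
    coreF q e Q (boolPair x (ones R)) = [IWStrong.strongBit q L₁ x] := by
  suffices h0 : coreF0 q e Q (boolPair x (ones R)) = [IWStrong.strongBit q L₁ x] by
    rw [coreF, Function.comp_apply, fanoutFn_apply, h0, eqPairFn_boolPair]
    cases IWStrong.strongBit q L₁ x <;> rfl
  have hc1 : (isNilFn ∘ cT q) (boolPair x (ones R)) = [decide (IWStrong.scaleOf q x.length = 0)] := by
    rw [Function.comp_apply, cT, Function.comp_apply, fstF_boolPair, scaleOfF_apply, isNilFn_ones]
  rw [coreF0, iteFn_apply hc1]
  by_cases ht0 : IWStrong.scaleOf q x.length = 0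
  · -- scale zero: the strong bit is `0`
    rw [if_pos (decide_eq_true ht0)]
    unfold IWStrong.strongBit
    rw [ht0]
    split_ifs with h
    · rw [strongFn_zero]
    · rfl
  rw [if_neg (by rw [decide_eq_true_iff]; exact ht0)]
  have ht1 : 1 ≤ IWStrong.scaleOf q x.length := Nat.one_le_iff_ne_zero.2 ht0
  have hseed : IWStrong.seedLen q (IWStrong.scaleOf q x.length) ≤ x.length :=
    (Nat.findGreatest_eq_iff.1 (rfl : IWStrong.scaleOf q x.length = _)).2.1 ht0
  have hLW := (cBricks_apply q x (ones R) rfl ht1 hseed (by simp only [ones, List.length_replicate]; exact hR)).2.2.2.2.2.2.2.2.2.2.2.1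
  have hc2 : (isNilFn ∘ lastWordF q) (boolPair x (ones R)) =
      [decide ((NWMachine.designStrs (2 * q) (4 * q) (IWStrong.scaleOf q x.length)).getD (2 ^ IWStrong.aOf q (IWStrong.scaleOf q x.length) - 1) [] = [])] := by
    rw [Function.comp_apply, hLW]; rfl
  rw [iteFn_apply hc2]
  have hbit : IWStrong.strongBit q L₁ x = IWStrong.strongFn q L₁ (IWStrong.scaleOf q x.length) fun j => x.get (Fin.castLE hseed j) := by
    unfold IWStrong.strongBit
    rw [dif_pos hseed]
  rw [hbit]
  by_cases hnil : (NWMachine.designStrs (2 * q) (4 * q) (IWStrong.scaleOf q x.length)).getD (2 ^ IWStrong.aOf q (IWStrong.scaleOf q x.length) - 1) [] = []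
  · -- too few design words
    rw [if_pos (decide_eq_true hnil)]
    unfold IWStrong.strongFn
    rw [dif_neg ((lastWord_eq_nil_iff q hq ht1).1 hnil)]
  rw [if_neg (by rw [decide_eq_true_iff]; exact hnil), Function.comp_apply]
  have hdes : IWStrong.kOf q (IWStrong.scaleOf q x.length) ≤
      (lexWords (IWStrong.NOf q (IWStrong.scaleOf q x.length)) (IWStrong.bOf q) (IWStrong.scaleOf q x.length)).length := by
    have := (lastWord_eq_nil_iff q hq ht1).not.1 hnil; push Not at this; exact this
  exact coreF_apply_pos q e Q L₁ x rfl ht1 hseed hR hdes hrun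

end Value

/-! ### The padded language is in `P`; the language is in `E` -/

section Top2

variable (e : List Bool) (Q : Polynomial ℕ)

/-- **The decision function on the padded input** `1^{2^{|x|}} 0 x`. [folklore] -/
def topF : List Bool → List Bool := coreF q e Q ∘ fanoutFn HardLangM.restT.eval HardLangM.padT.eval

/-- `topF ∈ FP`. [folklore] -/
theorem topF_mem_FP : topF q e Q ∈ FP :=
  comp_mem_FP (coreF_mem_FP q e Q).2 (fanoutFn_mem_FP HardLangM.restT.polyTimeComputable_eval HardLangM.padT.polyTimeComputable_eval)

/-- **Value on a padded input.** [folklore] -/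
theorem topF_expPad (hq : 1 ≤ q) (L₁ : Language Bool) (x : List Bool)
    (hrun : ∀ u : List Bool, u.length ≤ x.length → ClockedUS.run (boolPair e u) (Q.eval (2 ^ x.length)) = some [L₁.boolIndicator u]) :
    topF q e Q (expPad 1 x) = [IWStrong.strongBit q L₁ x] := by
  have hw : expPad 1 x = ones (2 ^ x.length) ++ false :: x := by simp [expPad, ones]
  rw [topF, Function.comp_apply, fanoutFn_apply, hw, HardLangM.restT_eval, HardLangM.padT_eval]
  exact coreF_apply q e Q L₁ hq x le_rfl hrun

/-- **The padded strong language** decided by `topF`. [folklore] -/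
def strongLangPad : Language Bool := {w | topF q e Q w = [true]}

/-- The padded strong language is in `P`. [folklore] -/
theorem strongLangPad_mem_P : strongLangPad q e Q ∈ Classes.P := by
  refine mem_P_of_mem_FP (topF_mem_FP q e Q) _ fun w => ⟨fun h => h, fun h => ?_⟩
  obtain ⟨b, hb⟩ : ∃ b, topF q e Q w = [b] := (oneBit_coreF q e Q).comp _ w
  cases b with
  | true => exact absurd hb h
  | false => exact hb

/-- **Padding**: `x ∈ strongLang q L₁ ↔ expPad 1 x ∈ strongLangPad`. [folklore] -/
theorem mem_strongLang_iff (hq : 1 ≤ q) (L₁ : Language Bool)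
    (hrun : ∀ (x u : List Bool), u.length ≤ x.length → ClockedUS.run (boolPair e u) (Q.eval (2 ^ x.length)) = some [L₁.boolIndicator u])
    (x : List Bool) : x ∈ IWStrong.strongLang q L₁ ↔ expPad 1 x ∈ strongLangPad q e Q := by
  change IWStrong.strongBit q L₁ x = true ↔ topF q e Q (expPad 1 x) = [true]
  rw [topF_expPad q e Q hq L₁ x (hrun x)]
  simp

end Top2

/-- **The strong language of a language in `E` is in `E`** (Impagliazzo–Wigderson 1997, Thm. 1:
"`E` is closed under the amplification"; here: the padded language is in `P` by `topF`, and upward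
translation `ExpPadding.exists_timeDecidable_of_expPad` with a linear-exponential pad).
[cite: ImpagliazzoWigderson1997, Thm. 1] -/
theorem strongLang_mem_E (hq : 1 ≤ q) {L₁ : Language Bool} (hL : L₁ ∈ E) : IWStrong.strongLang q L₁ ∈ E := by
  classical
  obtain ⟨e, Q, hrun⟩ := NWMachine.exists_run_of_mem_E hL 1
  have hrun' : ∀ (x u : List Bool), u.length ≤ x.length →
      ClockedUS.run (boolPair e u) (Q.eval (2 ^ x.length)) = some [L₁.boolIndicator u] := by
    intro x u hu
    refine hrun (2 ^ x.length) u ?_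
    rw [one_mul, NWMachine.tOf, Nat.log_pow (by norm_num)]
    omega
  have hP := strongLangPad_mem_P q e Q
  simp only [Classes.P, Set.mem_iUnion] at hP
  obtain ⟨j, c, hc⟩ := hP
  have hmono : Monotone fun n : ℕ => c * n ^ j + c := fun a b hab => by
    simp only
    exact Nat.add_le_add_right (Nat.mul_le_mul_left c (Nat.pow_le_pow_left hab j)) c
  obtain ⟨C, hC⟩ := exists_timeDecidable_of_expPad (k := 1) le_rfl hmono (mem_strongLang_iff q e Q hq L₁ hrun') hc
  obtain ⟨c', hc'⟩ := HardLangM.translation_bound C c j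
  obtain ⟨M, hM⟩ := hC
  simp only [E, Set.mem_iUnion]
  exact ⟨j + 1, c', M, hM.mono fun x => hc' x.length⟩

end IWStrongM

end Literature.Computability.Complexity

end
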